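import Summits.MatrixMultiplication.MatrixMultiplication.Theses.DefinableSTPPDichotomy

/-!
# Crux `PairwiseCurvedTilingsLC` (stmt-MatrixMultiplication-17883) — candidate DISPROOF, Lean part
(planner crux-ideate r1 k1, 2026-08-17; hand proof of the remaining hypothesis in
`NEGATIVE-lonely-translates.md` of this crux directory)

PROVED here (sorry-free, standard axioms):
* §1 combinatorial core ("lonely translates"): under the `i = j` pattern of the STPP clause, every
  translate `(s' − u) − t + B_i` of `B_i` through a point `s' − u` of the `A − C` shadow
  `𝒰 = ⋃_k (A_k − C_k)` meets `𝒰` in that single point (`lonely_translate`,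
  `card_translate_inter_acShadow`); packing `|𝒰| = Σ|A_k||C_k|` (`card_acShadow`); rotation
  invariance of the pairwise clause; block TPP bound.
* §2 `notLC_of_shadowBound : PorosityShadowBound → ¬ PairwiseCurvedTilingsLC` — the crux is
  refuted by the definable no-go `PorosityShadowBound` (elementary counting: three packings,
  three-term AM–GM with weight `q^{-1/3}`, `ε := 1/(m+1)`).
* §3 `notLC_of_recurrence : DefinableTranslateRecurrence → ¬ PairwiseCurvedTilingsLC` — the
  same refutation from ideator k=2's LITERATURE-SHAPED named fact (verbatim copy of the `def` in
  `ChebotarevRecurrenceSketch.lean`), INCLUDING the first-order plumbing: the shadow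
  `⋃_x (B_x − C_x)` (`shadowFormula`, `mem_bcShadow_iff_realize`) and the block `A_x`
  (`blockFormula`, `mem_block_iff_realize`) as realised ring formulas, the packing `card_bcShadow`,
  k=2's `isolating_translates`, and `bcShadow_le_of_recurrence` (recurrence ⇒ rotated shadow bound).
STATED (the remaining hypotheses, either suffices): `PorosityShadowBound` (family form) or
  `DefinableTranslateRecurrence` (two-formula form; Kiefe1976 / CDM (2.7) + Lang–Weil + uniform
  Chebotarev, KatzSarnak Thm 9.7.13) — hand proofs in the two negative notes of this directory.
-/

set_option linter.dupNamespace false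

namespace Summit.MatrixMultiplication.MatrixMultiplication.Cruxes.PairwiseCurvedTilingsLC.Negative

open Finset
open Summit.MatrixMultiplication.MatrixMultiplication.Theses.DefinableSTPPDichotomy

section Combinatorial

variable {H : Type*} [AddCommGroup H] {ι : Type*}

/-- The `i = j` pattern of the CKSU STPP clause (it contains the block TPP, `k = i`, and the
porosity of the `A − C` packing along `B − B`, `k ≠ i`). -/
def PatternIJ (I : Finset ι) (A B C : ι → Finset H) : Prop :=
  ∀ i ∈ I, ∀ k ∈ I, ∀ s ∈ A k, ∀ s' ∈ A i, ∀ t ∈ B i, ∀ t' ∈ B i, ∀ u ∈ C i, ∀ u' ∈ C k,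
    (s' - s) + (t' - t) + (u' - u) = 0 → i = k ∧ s = s' ∧ t = t' ∧ u = u'

/-- The `A − C` shadow `𝒰 = ⋃_{k ∈ I} (A_k − C_k)`. -/
def acShadow [DecidableEq H] (I : Finset ι) (A C : ι → Finset H) : Finset H :=
  I.biUnion fun k => image₂ (· - ·) (A k) (C k)

/-- The pairwise (≥ 2 equal labels) clause of the crux, for an arbitrary index type. -/
def PairwiseClause (I : Finset ι) (A B C : ι → Finset H) : Prop :=
  ∀ i ∈ I, ∀ j ∈ I, ∀ k ∈ I, (i = j ∨ j = k ∨ k = i) →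
    ∀ s ∈ A k, ∀ s' ∈ A i, ∀ t ∈ B i, ∀ t' ∈ B j, ∀ u ∈ C j, ∀ u' ∈ C k,
      (s' - s) + (t' - t) + (u' - u) = 0 → i = j ∧ j = k ∧ s = s' ∧ t = t' ∧ u = u'

/-- The pairwise clause implies the `i = j` pattern. -/
theorem patternIJ_of_pairwise {I : Finset ι} {A B C : ι → Finset H}
    (h : PairwiseClause I A B C) : PatternIJ I A B C := by
  intro i hi k hk s hs s' hs' t ht t' ht' u hu u' hu' h0
  obtain ⟨-, hik, hss, htt, huu⟩ := h i hi i hi k hk (Or.inl rfl) s hs s' hs' t ht t' ht' u hu u' hu' h0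
  exact ⟨hik, hss, htt, huu⟩

/-- **Lonely translates.**  Under the `i = j` pattern: if `s' ∈ A_i`, `u ∈ C_i`, `t, t' ∈ B_i` and
`(s' − u) + (t' − t)` lies in the `A − C` shadow, then `t' = t`.  Equivalently the translate
`(s' − u) − t + B_i` meets `⋃_k (A_k − C_k)` only in `s' − u` (and `t' ↦ (s'−u)+(t'−t)` is
injective), although it has `|B_i|` points. -/
theorem lonely_translate [DecidableEq H] {I : Finset ι} {A B C : ι → Finset H}
    (h : PatternIJ I A B C) {i : ι} (hi : i ∈ I) {s' u t t' : H} (hs' : s' ∈ A i) (hu : u ∈ C i)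
    (ht : t ∈ B i) (ht' : t' ∈ B i) (hmem : (s' - u) + (t' - t) ∈ acShadow I A C) : t' = t := by
  simp only [acShadow, mem_biUnion, mem_image₂] at hmem
  obtain ⟨k, hk, s, hs, u', hu', he⟩ := hmem
  have h0 : (s' - s) + (t' - t) + (u' - u) = 0 := by
    have : (s' - s) + (t' - t) + (u' - u) = ((s' - u) + (t' - t)) - (s - u') := by abel
    rw [this, ← he, sub_self]
  exact ((h i hi k hk s hs s' hs' t ht t' ht' u hu u' hu' h0).2.2.1).symm

/-- The point `s' − u` itself does lie in the shadow. -/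
theorem base_mem_acShadow [DecidableEq H] {I : Finset ι} {A C : ι → Finset H} {i : ι} (hi : i ∈ I)
    {s' u : H} (hs' : s' ∈ A i) (hu : u ∈ C i) : s' - u ∈ acShadow I A C := by
  simp only [acShadow, mem_biUnion, mem_image₂]
  exact ⟨i, hi, s', hs', u, hu, rfl⟩

/-- Counting form: the translate `{(s' − u) + (t' − t) : t' ∈ B_i}` has exactly ONE point in the
shadow. -/
theorem card_translate_inter_acShadow [DecidableEq H] {I : Finset ι} {A B C : ι → Finset H}
    (h : PatternIJ I A B C) {i : ι} (hi : i ∈ I) {s' u t : H} (hs' : s' ∈ A i) (hu : u ∈ C i)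
    (ht : t ∈ B i) :
    ((B i).image fun t' => (s' - u) + (t' - t)).filter (· ∈ acShadow I A C) = {s' - u} := by
  ext v
  simp only [mem_filter, mem_image, mem_singleton]
  constructor
  · rintro ⟨⟨t', ht', rfl⟩, hv⟩
    rw [lonely_translate h hi hs' hu ht ht' hv, sub_self, add_zero]
  · rintro rfl
    exact ⟨⟨t, ht, by rw [sub_self, add_zero]⟩, base_mem_acShadow hi hs' hu⟩

/-- The shadow is a disjoint union and each block embeds: `|𝒰| = Σ_k |A_k||C_k|` (packing, from the
`t = t'` instances of the pattern). -/
theorem card_acShadow [DecidableEq H] {I : Finset ι} {A B C : ι → Finset H}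
    (h : PatternIJ I A B C) (hB : ∀ k ∈ I, (B k).Nonempty) :
    (acShadow I A C).card = ∑ k ∈ I, (A k).card * (C k).card := by
  classical
  rw [acShadow, card_biUnion]
  · refine sum_congr rfl fun k hk => ?_
    rw [card_image₂_iff.2]
    intro ⟨a, c⟩ hac ⟨a', c'⟩ hac' heq
    simp only [Set.mem_prod, mem_coe] at hac hac'
    obtain ⟨t, ht⟩ := hB k hk
    have h0 : (a' - a) + (t - t) + (c - c') = 0 := by
      have : (a' - a) + (t - t) + (c - c') = (a' - c') - (a - c) := by abel
      rw [this]; exact sub_eq_zero.2 heq.symm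
    obtain ⟨-, haa, -, hcc⟩ := h k hk k hk a hac.1 a' hac'.1 t ht t ht c' hac'.2 c hac.2 h0
    exact Prod.ext haa hcc.symm
  · intro k hk l hl hkl
    rw [Function.onFun, disjoint_left]
    intro v hvk hvl
    simp only [mem_image₂] at hvk hvl
    obtain ⟨a, ha, c, hc, rfl⟩ := hvk
    obtain ⟨a', ha', c', hc', he⟩ := hvl
    obtain ⟨t, ht⟩ := hB k hk
    have h0 : (a - a') + (t - t) + (c' - c) = 0 := by
      have : (a - a') + (t - t) + (c' - c) = (a - c) - (a' - c') := by abel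
      rw [this, he, sub_self]
    exact hkl (h k hk l hl a' ha' a ha t ht t ht c hc c' hc' h0).1

end Combinatorial

section Packing

variable {H : Type*} [AddCommGroup H] {ι : Type*}

/-- The pairwise clause is invariant under the rotation `(A, B, C) ↦ (B, C, A)`. -/
theorem pairwiseClause_rotate {I : Finset ι} {A B C : ι → Finset H} (h : PairwiseClause I A B C) :
    PairwiseClause I B C A := by
  intro i hi j hj k hk hijk s hs s' hs' t ht t' ht' u hu u' hu' h0
  -- original clause with `(i₀, j₀, k₀) := (k, i, j)`, `s₀ := u, s₀' := u', t₀ := s, t₀' := s', u₀ := t, u₀' := t'`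
  have h0' : (u' - u) + (s' - s) + (t' - t) = 0 := by rw [← h0]; abel
  have hor : (k = i ∨ i = j ∨ j = k) := by tauto
  obtain ⟨hki, hij, huu, hss, htt⟩ := h k hk i hi j hj hor u hu u' hu' s hs s' hs' t ht t' ht' h0'
  exact ⟨hij, hij.symm.trans hki.symm, hss, htt, huu⟩

/-- Restriction of the clause to a sub-index-set. -/
theorem pairwiseClause_mono {I J : Finset ι} {A B C : ι → Finset H} (hJI : J ⊆ I)
    (h : PairwiseClause I A B C) : PairwiseClause J A B C :=
  fun i hi j hj k hk => h i (hJI hi) j (hJI hj) k (hJI hk)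

/-- `A − C` packing: `Σ_k |A_k||C_k| ≤ |H|` (all `B_k ≠ ∅`). -/
theorem sum_card_mul_card_le [Fintype H] [DecidableEq H] {I : Finset ι} {A B C : ι → Finset H}
    (h : PatternIJ I A B C) (hB : ∀ k ∈ I, (B k).Nonempty) :
    ∑ k ∈ I, (A k).card * (C k).card ≤ Fintype.card H := by
  rw [← card_acShadow h hB]; exact card_le_univ _

/-- Block TPP: `|A_i||B_i||C_i| ≤ |H|` (the sum map is injective on `A_i × B_i × C_i`). -/
theorem card_mul_card_mul_card_le [Fintype H] {I : Finset ι} {A B C : ι → Finset H}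
    (h : PatternIJ I A B C) {i : ι} (hi : i ∈ I) :
    (A i).card * (B i).card * (C i).card ≤ Fintype.card H := by
  classical
  have hinj : Set.InjOn (fun p : H × H × H => p.1 + (p.2.1 + p.2.2))
      ((A i) ×ˢ ((B i) ×ˢ (C i)) : Finset (H × H × H)) := by
    rintro ⟨a₁, b₁, c₁⟩ h₁ ⟨a₂, b₂, c₂⟩ h₂ heq
    simp only [coe_product, Set.mem_prod, mem_coe] at h₁ h₂
    have h0 : (a₁ - a₂) + (b₁ - b₂) + (c₁ - c₂) = 0 := by
      have : (a₁ - a₂) + (b₁ - b₂) + (c₁ - c₂) = (a₁ + (b₁ + c₁)) - (a₂ + (b₂ + c₂)) := by abel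
      rw [this]; exact sub_eq_zero.2 heq
    obtain ⟨-, ha, hb, hc⟩ := h i hi i hi a₂ h₂.1 a₁ h₁.1 b₂ h₂.2.1 b₁ h₁.2.1 c₂ h₂.2.2 c₁ h₁.2.2 h0
    rw [ha, hb, hc]
  have := card_le_card_of_injOn _ (fun p _ => mem_univ _) hinj
  simpa [card_product, card_univ, mul_assoc] using this

end Packing

/-! ## §2 The definable no-go (statement) and the target implication (PROVED modulo the no-go)

`PorosityShadowBound` is the theorem claimed in the negative note (proof: CDM (2.7) normal form,
étaleness at simple roots in large characteristic, smooth F-point ⇒ absolutely irreducible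
component, Lang–Weil lower bound, `card_translate_inter_acShadow`).  `notLC_of_shadowBound`
(elementary: the three packings, three-term AM–GM with weight `q^{-1/3}`, and
`(abc)^{(2+ε)/3} ≤ C·ac` on the blocks with `|B| ≤ C`) is PROVED below. -/

/-- **Definable porosity shadow bound** (claimed; see the negative note for the proof sketch):
for ring formulas of fixed complexity there are `C, q₁` such that in every finite field of
characteristic `≥ q₁` every realised family satisfying the `i = j` pattern has
`Σ_{x : |B_x| > C} |A_x||C_x| ≤ C·|F|^{m−1}` — the blocks whose `B`-set is positive-dimensional
have an `A − C` shadow of LOWER dimension.  (Real exponent `m − 1`; for `m = 0` the sum is empty.) -/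
def PorosityShadowBound : Prop :=
  ∀ (e m k : ℕ) (φI : FirstOrder.Language.ring.Formula (Fin e ⊕ Fin k))
    (φA φB φC : FirstOrder.Language.ring.Formula ((Fin e ⊕ Fin m) ⊕ Fin k)),
    ∃ C q₁ : ℕ, ∀ (F : Type) [Field F] [Fintype F] [FirstOrder.Ring.CompatibleRing F],
      q₁ ≤ ringChar F →
      ∀ (y : Fin k → F) (I : Finset (Fin e → F)) (A B C' : (Fin e → F) → Finset (Fin m → F)),
        (∀ x, x ∈ I ↔ φI.Realize (Sum.elim x y)) →
        (∀ x v, v ∈ A x ↔ φA.Realize (Sum.elim (Sum.elim x v) y)) →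
        (∀ x v, v ∈ B x ↔ φB.Realize (Sum.elim (Sum.elim x v) y)) →
        (∀ x v, v ∈ C' x ↔ φC.Realize (Sum.elim (Sum.elim x v) y)) →
        PatternIJ I A B C' →
        ((∑ x ∈ I.filter (fun x => C < (B x).card), (A x).card * (C' x).card : ℕ) : ℝ)
          ≤ C * (Fintype.card F : ℝ) ^ ((m : ℝ) - 1)

/-- Target implication: the shadow bound refutes the crux. -/
def NotLCOfShadowBound : Prop := PorosityShadowBound → ¬ PairwiseCurvedTilingsLC

section MassBound

variable {H : Type*} [AddCommGroup H] [Fintype H] {ι : Type*}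

/-- The per-block inequality behind the big-`B` part: three-term AM–GM with weights `1/3` on
`(λab, λbc, μca)`, `λ = q^{-1/3}`, `μ = q^{2/3}`, and `(abc)^{ε/3} ≤ q^{mε/3} ≤ q^{1/3}`. -/
theorem rpow_block_le {q : ℝ} (hq : 1 ≤ q) {m : ℕ} {a b c : ℝ} (ha : 0 ≤ a) (hb : 0 ≤ b)
    (hc : 0 ≤ c) (h1 : 1 ≤ a * b * c) (hqm : a * b * c ≤ q ^ (m : ℝ)) {ε : ℝ} (hε : 0 < ε)
    (hmε : (m : ℝ) * ε ≤ 1) :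
    (a * b * c) ^ ((2 + ε) / 3) ≤ q ^ ((1 : ℝ) / 3) *
      ((q ^ (-(1 : ℝ) / 3) * (a * b) + q ^ (-(1 : ℝ) / 3) * (b * c) +
        q ^ ((2 : ℝ) / 3) * (c * a)) / 3) := by
  have hq0 : 0 < q := by linarith
  have hN : 0 < a * b * c := by linarith
  have hl0 : 0 < q ^ (-(1 : ℝ) / 3) := Real.rpow_pos_of_pos hq0 _
  have hm0 : 0 < q ^ ((2 : ℝ) / 3) := Real.rpow_pos_of_pos hq0 _
  have hlm : q ^ (-(1 : ℝ) / 3) * q ^ (-(1 : ℝ) / 3) * q ^ ((2 : ℝ) / 3) = 1 := by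
    rw [← Real.rpow_add hq0, ← Real.rpow_add hq0]; norm_num
  -- split the exponent
  have hsplit : (a * b * c) ^ ((2 + ε) / 3) =
      (a * b * c) ^ ((2 : ℝ) / 3) * (a * b * c) ^ (ε / 3) := by
    rw [← Real.rpow_add hN]; congr 1; ring
  -- the `ε/3` part
  have h2 : (a * b * c) ^ (ε / 3) ≤ q ^ ((1 : ℝ) / 3) := by
    calc (a * b * c) ^ (ε / 3) ≤ (q ^ (m : ℝ)) ^ (ε / 3) :=
          Real.rpow_le_rpow hN.le hqm (by linarith)
      _ = q ^ ((m : ℝ) * (ε / 3)) := by rw [← Real.rpow_mul hq0.le]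
      _ ≤ q ^ ((1 : ℝ) / 3) := Real.rpow_le_rpow_of_exponent_le hq (by nlinarith)
  -- AM–GM
  have hg := Real.geom_mean_le_arith_mean3_weighted (w₁ := 1 / 3) (w₂ := 1 / 3) (w₃ := 1 / 3)
    (p₁ := q ^ (-(1 : ℝ) / 3) * (a * b)) (p₂ := q ^ (-(1 : ℝ) / 3) * (b * c))
    (p₃ := q ^ ((2 : ℝ) / 3) * (c * a)) (by norm_num) (by norm_num) (by norm_num)
    (by positivity) (by positivity) (by positivity) (by norm_num)
  have hprod : (q ^ (-(1 : ℝ) / 3) * (a * b)) ^ ((1 : ℝ) / 3) *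
      (q ^ (-(1 : ℝ) / 3) * (b * c)) ^ ((1 : ℝ) / 3) *
      (q ^ ((2 : ℝ) / 3) * (c * a)) ^ ((1 : ℝ) / 3) = (a * b * c) ^ ((2 : ℝ) / 3) := by
    rw [← Real.mul_rpow (by positivity) (by positivity),
      ← Real.mul_rpow (by positivity) (by positivity)]
    have e : q ^ (-(1 : ℝ) / 3) * (a * b) * (q ^ (-(1 : ℝ) / 3) * (b * c)) *
        (q ^ ((2 : ℝ) / 3) * (c * a)) = (a * b * c) ^ (2 : ℕ) := by
      have : q ^ (-(1 : ℝ) / 3) * (a * b) * (q ^ (-(1 : ℝ) / 3) * (b * c)) *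
          (q ^ ((2 : ℝ) / 3) * (c * a)) =
          (q ^ (-(1 : ℝ) / 3) * q ^ (-(1 : ℝ) / 3) * q ^ ((2 : ℝ) / 3)) * (a * b * c) ^ (2 : ℕ) := by
        ring
      rw [this, hlm, one_mul]
    rw [e, ← Real.rpow_natCast, ← Real.rpow_mul hN.le]
    norm_num
  have h1 : (a * b * c) ^ ((2 : ℝ) / 3) ≤
      (q ^ (-(1 : ℝ) / 3) * (a * b) + q ^ (-(1 : ℝ) / 3) * (b * c) +
        q ^ ((2 : ℝ) / 3) * (c * a)) / 3 := by
    rw [← hprod]; linarith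
  rw [hsplit]
  calc (a * b * c) ^ ((2 : ℝ) / 3) * (a * b * c) ^ (ε / 3)
      ≤ ((q ^ (-(1 : ℝ) / 3) * (a * b) + q ^ (-(1 : ℝ) / 3) * (b * c) +
          q ^ ((2 : ℝ) / 3) * (c * a)) / 3) * q ^ ((1 : ℝ) / 3) :=
        mul_le_mul h1 h2 (by positivity) (by positivity)
    _ = _ := by ring

set_option maxHeartbeats 1600000 in
/-- **Mass bound from a shadow bound** (the counting of §2 of the note).  For a family satisfying
the pairwise clause in a finite abelian group of order `q^m` (`q ≥ 1`), if the blocks with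
`|B| > C` have `Σ |A||C| ≤ C q^{m−1}`, then for every `0 < ε ≤ 1` with `mε ≤ 1` the mass at
exponent `(2+ε)/3` is at most `(C + (2+C)/3)·q^m`. -/
theorem mass_le_of_shadowBound [DecidableEq H] (I : Finset ι) (A B C : ι → Finset H)
    (h : PairwiseClause I A B C) (Cb : ℕ) {q : ℝ} (hq : 1 ≤ q) (m : ℕ)
    (hH : (Fintype.card H : ℝ) = q ^ (m : ℝ))
    (hshadow : ∑ x ∈ I.filter (fun x => Cb < (B x).card), ((A x).card : ℝ) * (C x).card
      ≤ Cb * q ^ ((m : ℝ) - 1))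
    {ε : ℝ} (hε : 0 < ε) (hε1 : ε ≤ 1) (hmε : (m : ℝ) * ε ≤ 1) :
    ∑ x ∈ I, (((A x).card * (B x).card * (C x).card : ℕ) : ℝ) ^ ((2 + ε) / 3)
      ≤ ((Cb : ℝ) + (2 + Cb) / 3) * q ^ (m : ℝ) := by
  have hq0 : 0 < q := by linarith
  have hp0 : 0 < (2 + ε) / 3 := by linarith
  have hp1 : (2 + ε) / 3 ≤ 1 := by linarith
  -- blocks with all three sets non-empty
  let I₀ := I.filter fun x => (A x).Nonempty ∧ (B x).Nonempty ∧ (C x).Nonempty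
  have hI₀I : I₀ ⊆ I := filter_subset _ _
  have hne : ∀ x ∈ I₀, (A x).Nonempty ∧ (B x).Nonempty ∧ (C x).Nonempty := fun x hx =>
    (mem_filter.1 hx).2
  have hsum0 : ∑ x ∈ I, (((A x).card * (B x).card * (C x).card : ℕ) : ℝ) ^ ((2 + ε) / 3) =
      ∑ x ∈ I₀, (((A x).card * (B x).card * (C x).card : ℕ) : ℝ) ^ ((2 + ε) / 3) := by
    rw [sum_filter_of_ne]
    intro x _ hx
    by_contra hcon
    apply hx
    have h0 : (A x).card * (B x).card * (C x).card = 0 := by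
      simp only [not_and_or, not_nonempty_iff_eq_empty] at hcon
      rcases hcon with h' | h' | h' <;> simp [h']
    rw [h0, Nat.cast_zero, Real.zero_rpow hp0.ne']
  -- the three patterns on `I₀`
  have h₀ : PairwiseClause I₀ A B C := pairwiseClause_mono hI₀I h
  have hIJ : PatternIJ I₀ A B C := patternIJ_of_pairwise h₀
  have hIJ' : PatternIJ I₀ B C A := patternIJ_of_pairwise (pairwiseClause_rotate h₀)
  have hIJ'' : PatternIJ I₀ C A B :=
    patternIJ_of_pairwise (pairwiseClause_rotate (pairwiseClause_rotate h₀))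
  -- packings (as reals)
  have hAC : ∑ x ∈ I₀, ((A x).card : ℝ) * (C x).card ≤ q ^ (m : ℝ) := by
    have := sum_card_mul_card_le hIJ fun x hx => (hne x hx).2.1
    rw [← hH]; exact_mod_cast this
  have hBA : ∑ x ∈ I₀, ((B x).card : ℝ) * (A x).card ≤ q ^ (m : ℝ) := by
    have := sum_card_mul_card_le hIJ' fun x hx => (hne x hx).2.2
    rw [← hH]; exact_mod_cast this
  have hCB : ∑ x ∈ I₀, ((C x).card : ℝ) * (B x).card ≤ q ^ (m : ℝ) := by
    have := sum_card_mul_card_le hIJ'' fun x hx => (hne x hx).1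
    rw [← hH]; exact_mod_cast this
  have habc : ∀ x ∈ I₀, ((A x).card : ℝ) * (B x).card * (C x).card ≤ q ^ (m : ℝ) := by
    intro x hx
    rw [← hH]; exact_mod_cast card_mul_card_mul_card_le hIJ hx
  have habc1 : ∀ x ∈ I₀, (1 : ℝ) ≤ ((A x).card : ℝ) * (B x).card * (C x).card := by
    intro x hx
    obtain ⟨ha, hb, hc⟩ := hne x hx
    have : 1 ≤ (A x).card * (B x).card * (C x).card :=
      Nat.mul_pos (Nat.mul_pos ha.card_pos hb.card_pos) hc.card_pos
    exact_mod_cast this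
  have hcast : ∀ x, (((A x).card * (B x).card * (C x).card : ℕ) : ℝ) =
      ((A x).card : ℝ) * (B x).card * (C x).card := fun x => by push_cast; ring
  rw [hsum0, ← sum_filter_add_sum_filter_not I₀ (fun x => Cb < (B x).card)]
  simp_rw [hcast]
  -- (1) small-`B` blocks: `(abc)^p ≤ abc ≤ Cb·ac`
  have hT : ∑ x ∈ I₀.filter (fun x => ¬ Cb < (B x).card),
      (((A x).card : ℝ) * (B x).card * (C x).card) ^ ((2 + ε) / 3) ≤ Cb * q ^ (m : ℝ) := by
    calc ∑ x ∈ I₀.filter (fun x => ¬ Cb < (B x).card),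
          (((A x).card : ℝ) * (B x).card * (C x).card) ^ ((2 + ε) / 3)
        ≤ ∑ x ∈ I₀.filter (fun x => ¬ Cb < (B x).card), (Cb : ℝ) * (((A x).card : ℝ) * (C x).card) := by
          refine sum_le_sum fun x hx => ?_
          obtain ⟨hx₀, hxb⟩ := mem_filter.1 hx
          have hb : ((B x).card : ℝ) ≤ Cb := by exact_mod_cast not_lt.1 hxb
          calc (((A x).card : ℝ) * (B x).card * (C x).card) ^ ((2 + ε) / 3)
              ≤ ((A x).card : ℝ) * (B x).card * (C x).card :=
                Real.rpow_le_self_of_one_le (habc1 x hx₀) hp1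
            _ = ((B x).card : ℝ) * (((A x).card : ℝ) * (C x).card) := by ring
            _ ≤ (Cb : ℝ) * (((A x).card : ℝ) * (C x).card) := by gcongr
      _ ≤ ∑ x ∈ I₀, (Cb : ℝ) * (((A x).card : ℝ) * (C x).card) :=
          sum_le_sum_of_subset_of_nonneg (filter_subset _ _) fun x _ _ => by positivity
      _ = Cb * ∑ x ∈ I₀, ((A x).card : ℝ) * (C x).card := by rw [mul_sum]
      _ ≤ Cb * q ^ (m : ℝ) := by gcongr
  -- (2) big-`B` blocks
  have hSI : I₀.filter (fun x => Cb < (B x).card) ⊆ I.filter fun x => Cb < (B x).card := by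
    intro x hx
    obtain ⟨hx₀, hxb⟩ := mem_filter.1 hx
    exact mem_filter.2 ⟨hI₀I hx₀, hxb⟩
  have hSsh : ∑ x ∈ I₀.filter (fun x => Cb < (B x).card), ((C x).card : ℝ) * (A x).card
      ≤ Cb * q ^ ((m : ℝ) - 1) := by
    calc ∑ x ∈ I₀.filter (fun x => Cb < (B x).card), ((C x).card : ℝ) * (A x).card
        = ∑ x ∈ I₀.filter (fun x => Cb < (B x).card), ((A x).card : ℝ) * (C x).card :=
          sum_congr rfl fun x _ => mul_comm _ _
      _ ≤ ∑ x ∈ I.filter (fun x => Cb < (B x).card), ((A x).card : ℝ) * (C x).card :=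
          sum_le_sum_of_subset_of_nonneg hSI fun x _ _ => by positivity
      _ ≤ Cb * q ^ ((m : ℝ) - 1) := hshadow
  have hSab : ∑ x ∈ I₀.filter (fun x => Cb < (B x).card), ((A x).card : ℝ) * (B x).card
      ≤ q ^ (m : ℝ) := by
    calc ∑ x ∈ I₀.filter (fun x => Cb < (B x).card), ((A x).card : ℝ) * (B x).card
        ≤ ∑ x ∈ I₀, ((A x).card : ℝ) * (B x).card :=
          sum_le_sum_of_subset_of_nonneg (filter_subset _ _) fun x _ _ => by positivity
      _ = ∑ x ∈ I₀, ((B x).card : ℝ) * (A x).card := sum_congr rfl fun x _ => mul_comm _ _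
      _ ≤ q ^ (m : ℝ) := hBA
  have hSbc : ∑ x ∈ I₀.filter (fun x => Cb < (B x).card), ((B x).card : ℝ) * (C x).card
      ≤ q ^ (m : ℝ) := by
    calc ∑ x ∈ I₀.filter (fun x => Cb < (B x).card), ((B x).card : ℝ) * (C x).card
        ≤ ∑ x ∈ I₀, ((B x).card : ℝ) * (C x).card :=
          sum_le_sum_of_subset_of_nonneg (filter_subset _ _) fun x _ _ => by positivity
      _ = ∑ x ∈ I₀, ((C x).card : ℝ) * (B x).card := sum_congr rfl fun x _ => mul_comm _ _
      _ ≤ q ^ (m : ℝ) := hCB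
  have hS : ∑ x ∈ I₀.filter (fun x => Cb < (B x).card),
      (((A x).card : ℝ) * (B x).card * (C x).card) ^ ((2 + ε) / 3) ≤ (2 + Cb) / 3 * q ^ (m : ℝ) := by
    calc ∑ x ∈ I₀.filter (fun x => Cb < (B x).card),
          (((A x).card : ℝ) * (B x).card * (C x).card) ^ ((2 + ε) / 3)
        ≤ ∑ x ∈ I₀.filter (fun x => Cb < (B x).card), q ^ ((1 : ℝ) / 3) *
            ((q ^ (-(1 : ℝ) / 3) * (((A x).card : ℝ) * (B x).card) +
              q ^ (-(1 : ℝ) / 3) * (((B x).card : ℝ) * (C x).card) +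
              q ^ ((2 : ℝ) / 3) * (((C x).card : ℝ) * (A x).card)) / 3) := by
          refine sum_le_sum fun x hx => ?_
          have hx₀ : x ∈ I₀ := (mem_filter.1 hx).1
          exact rpow_block_le hq (Nat.cast_nonneg _) (Nat.cast_nonneg _) (Nat.cast_nonneg _)
            (habc1 x hx₀) (habc x hx₀) hε hmε
      _ = q ^ ((1 : ℝ) / 3) / 3 *
            (q ^ (-(1 : ℝ) / 3) * ∑ x ∈ I₀.filter (fun x => Cb < (B x).card),
                ((A x).card : ℝ) * (B x).card +
              q ^ (-(1 : ℝ) / 3) * ∑ x ∈ I₀.filter (fun x => Cb < (B x).card),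
                ((B x).card : ℝ) * (C x).card +
              q ^ ((2 : ℝ) / 3) * ∑ x ∈ I₀.filter (fun x => Cb < (B x).card),
                ((C x).card : ℝ) * (A x).card) := by
          rw [mul_sum, mul_sum, mul_sum, ← sum_add_distrib, ← sum_add_distrib, mul_sum]
          exact sum_congr rfl fun x _ => by ring
      _ ≤ q ^ ((1 : ℝ) / 3) / 3 *
            (q ^ (-(1 : ℝ) / 3) * q ^ (m : ℝ) + q ^ (-(1 : ℝ) / 3) * q ^ (m : ℝ) +
              q ^ ((2 : ℝ) / 3) * (Cb * q ^ ((m : ℝ) - 1))) := by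
          have hl0 : 0 ≤ q ^ (-(1 : ℝ) / 3) := (Real.rpow_pos_of_pos hq0 _).le
          have hm0 : 0 ≤ q ^ ((2 : ℝ) / 3) := (Real.rpow_pos_of_pos hq0 _).le
          have hq3 : 0 ≤ q ^ ((1 : ℝ) / 3) / 3 := by positivity
          apply mul_le_mul_of_nonneg_left _ hq3
          exact add_le_add (add_le_add (mul_le_mul_of_nonneg_left hSab hl0)
            (mul_le_mul_of_nonneg_left hSbc hl0)) (mul_le_mul_of_nonneg_left hSsh hm0)
      _ = (2 + Cb) / 3 * q ^ (m : ℝ) := by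
          have e1 : q ^ ((1 : ℝ) / 3) * q ^ (-(1 : ℝ) / 3) * q ^ (m : ℝ) = q ^ (m : ℝ) := by
            rw [← Real.rpow_add hq0, ← Real.rpow_add hq0]; norm_num
          have e2 : q ^ ((1 : ℝ) / 3) * q ^ ((2 : ℝ) / 3) * q ^ ((m : ℝ) - 1) = q ^ (m : ℝ) := by
            rw [← Real.rpow_add hq0, ← Real.rpow_add hq0]; norm_num
          have : q ^ ((1 : ℝ) / 3) / 3 *
              (q ^ (-(1 : ℝ) / 3) * q ^ (m : ℝ) + q ^ (-(1 : ℝ) / 3) * q ^ (m : ℝ) +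
                q ^ ((2 : ℝ) / 3) * (Cb * q ^ ((m : ℝ) - 1))) =
              (2 * (q ^ ((1 : ℝ) / 3) * q ^ (-(1 : ℝ) / 3) * q ^ (m : ℝ)) +
                Cb * (q ^ ((1 : ℝ) / 3) * q ^ ((2 : ℝ) / 3) * q ^ ((m : ℝ) - 1))) / 3 := by ring
          rw [this, e1, e2]; ring
  calc ∑ x ∈ I₀.filter (fun x => Cb < (B x).card),
          (((A x).card : ℝ) * (B x).card * (C x).card) ^ ((2 + ε) / 3) +
        ∑ x ∈ I₀.filter (fun x => ¬ Cb < (B x).card),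
          (((A x).card : ℝ) * (B x).card * (C x).card) ^ ((2 + ε) / 3)
      ≤ (2 + Cb) / 3 * q ^ (m : ℝ) + Cb * q ^ (m : ℝ) := add_le_add hS hT
    _ = ((Cb : ℝ) + (2 + Cb) / 3) * q ^ (m : ℝ) := by ring

end MassBound

/-- The characteristic of a finite field is at most its cardinality. -/
theorem ringChar_le_card (F : Type*) [Field F] [Fintype F] : ringChar F ≤ Fintype.card F := by
  obtain ⟨n, hp, hcard⟩ := FiniteField.card F (ringChar F)
  rw [hcard]
  exact Nat.le_self_pow n.ne_zero _

/-- **The shadow bound refutes the crux** (S2 of the note, PROVED): given `PorosityShadowBound`,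
`PairwiseCurvedTilingsLC` is false.  Take `ε := 1/(m+1)`; the crux supplies `η > 0` and fields of
arbitrarily large characteristic carrying families of mass `≥ |F|^{m+η}`; the shadow bound and
`mass_le_of_shadowBound` cap the mass at `K·|F|^m`, `K = C + (2+C)/3`; absurd once `|F|^η > K`. -/
theorem notLC_of_shadowBound : NotLCOfShadowBound := by
  intro hPSB hLC
  classical
  obtain ⟨e, m, k, φI, φA, φB, φC, hfam⟩ := hLC
  obtain ⟨Cb, q₁, hbd⟩ := hPSB e m k φI φA φB φC
  set ε : ℝ := 1 / ((m : ℝ) + 1) with hεdef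
  have hm0 : (0 : ℝ) ≤ m := Nat.cast_nonneg m
  have hε : 0 < ε := by rw [hεdef]; positivity
  have hε1 : ε ≤ 1 := by
    rw [hεdef, div_le_one (by linarith)]; linarith
  have hmε : (m : ℝ) * ε ≤ 1 := by
    rw [hεdef, mul_one_div, div_le_one (by linarith)]; linarith
  obtain ⟨η, hη, hall⟩ := hfam ε hε
  set K : ℝ := (Cb : ℝ) + (2 + Cb) / 3 with hK
  have hK0 : 0 < K := by rw [hK]; positivity
  -- a threshold beyond which `q^η > K`
  set N : ℕ := Nat.ceil ((K + 1) ^ (1 / η)) with hN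
  obtain ⟨F, instF, instFin, instCR, hchar, y, I, A, B, C', hI, hA, hB, hC, hpair, hmass⟩ :=
    hall (max q₁ (max N 2))
  have hcardF : max q₁ (max N 2) ≤ Fintype.card F := hchar.trans (ringChar_le_card F)
  set q : ℝ := (Fintype.card F : ℝ) with hqdef
  have hq2 : (2 : ℝ) ≤ q := by
    rw [hqdef]; exact_mod_cast le_trans (le_max_right _ _) (le_trans (le_max_right _ _) hcardF)
  have hq1 : (1 : ℝ) ≤ q := by linarith
  have hq0 : (0 : ℝ) < q := by linarith
  have hKq : K < q ^ η := by
    have h1 : (K + 1) ^ (1 / η) ≤ q := by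
      have : (N : ℝ) ≤ q := by
        rw [hqdef]; exact_mod_cast le_trans (le_max_left _ _) (le_trans (le_max_right _ _) hcardF)
      exact le_trans (Nat.le_ceil _) this
    have h2 : K + 1 ≤ q ^ η := by
      calc K + 1 = ((K + 1) ^ (1 / η)) ^ η := by
            rw [← Real.rpow_mul (by positivity), one_div, inv_mul_cancel₀ hη.ne', Real.rpow_one]
        _ ≤ q ^ η := Real.rpow_le_rpow (by positivity) h1 hη.le
    linarith
  -- the shadow bound for this family
  have hshadow := hbd F (le_trans (le_max_left _ _) hchar) y I A B C' hI hA hB hC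
    (patternIJ_of_pairwise hpair)
  -- the mass bound
  have hH : (Fintype.card (Fin m → F) : ℝ) = q ^ (m : ℝ) := by
    rw [Real.rpow_natCast, Fintype.card_fun, Fintype.card_fin]; push_cast; rfl
  have hshadow' : ∑ x ∈ I.filter (fun x => Cb < (B x).card), ((A x).card : ℝ) * (C' x).card
      ≤ Cb * q ^ ((m : ℝ) - 1) := by
    have := hshadow; push_cast at this; exact this
  have hmassle := mass_le_of_shadowBound I A B C' hpair Cb hq1 m hH hshadow' hε hε1 hmε
  -- contradiction: `q^{m+η} ≤ mass ≤ K q^m < q^η q^m = q^{m+η}`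
  have hlt : K * q ^ (m : ℝ) < q ^ ((m : ℝ) + η) := by
    rw [Real.rpow_add hq0, mul_comm]
    exact mul_lt_mul_of_pos_left hKq (Real.rpow_pos_of_pos hq0 _)
  exact absurd (hmass.trans hmassle) (not_le.2 hlt)

/-! ## §3 The literature-shaped recurrence principle (ideator k=2's `DefinableTranslateRecurrence`,
copied VERBATIM) also refutes the crux — PROVED below, including the first-order plumbing
(the shadow `⋃_x (B_x − C_x)` and the block `A_x` as realised ring formulas). -/

section Shadow

variable {H : Type*} [AddCommGroup H] {ι : Type*}

/-- Ideator k=2's combinatorial core, pattern `k = i` (re-proved for self-containedness): for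
`b ∈ B_i, c ∈ C_i, a₀ ≠ a ∈ A_i` the translate `(b − c) + a − a₀` lies in no class `B_j − C_j`. -/
theorem isolating_translates {I : Finset ι} {A B C : ι → Finset H} (h : PairwiseClause I A B C)
    {i : ι} (hi : i ∈ I) {b c a₀ a : H} (hb : b ∈ B i) (hc : c ∈ C i) (ha₀ : a₀ ∈ A i)
    (ha : a ∈ A i) (hne : a ≠ a₀) {j : ι} (hj : j ∈ I) {b' c' : H} (hb' : b' ∈ B j)
    (hc' : c' ∈ C j) : (b - c) + a - a₀ ≠ b' - c' := by
  intro he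
  have h0 : (a₀ - a) + (b' - b) + (c - c') = 0 := by
    have : (a₀ - a) + (b' - b) + (c - c') = (b' - c') - ((b - c) + a - a₀) := by abel
    rw [this, he, sub_self]
  exact hne (h i hi j hj i hi (Or.inr (Or.inr rfl)) a ha a₀ ha₀ b hb b' hb' c' hc' c hc h0).2.2.1

/-- The `B − C` shadow. -/
def bcShadow [DecidableEq H] (I : Finset ι) (B C : ι → Finset H) : Finset H :=
  I.biUnion fun k => image₂ (· - ·) (B k) (C k)

/-- `|⋃_k (B_k − C_k)| = Σ_k |B_k||C_k|` (packing from pattern `k = i`; all `A_k ≠ ∅`). -/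
theorem card_bcShadow [DecidableEq H] {I : Finset ι} {A B C : ι → Finset H}
    (h : PairwiseClause I A B C) (hA : ∀ k ∈ I, (A k).Nonempty) :
    (bcShadow I B C).card = ∑ k ∈ I, (B k).card * (C k).card := by
  classical
  rw [bcShadow, card_biUnion]
  · refine sum_congr rfl fun k hk => ?_
    rw [card_image₂_iff.2]
    intro ⟨b, c⟩ hbc ⟨b', c'⟩ hbc' heq
    simp only [Set.mem_prod, mem_coe] at hbc hbc'
    obtain ⟨a, ha⟩ := hA k hk
    have h0 : (a - a) + (b' - b) + (c - c') = 0 := by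
      have : (a - a) + (b' - b) + (c - c') = (b' - c') - (b - c) := by abel
      rw [this]; exact sub_eq_zero.2 heq.symm
    obtain ⟨-, -, -, hbb, hcc⟩ :=
      h k hk k hk k hk (Or.inl rfl) a ha a ha b hbc.1 b' hbc'.1 c' hbc'.2 c hbc.2 h0
    exact Prod.ext hbb hcc.symm
  · intro k hk l hl hkl
    rw [Function.onFun, disjoint_left]
    intro v hvk hvl
    simp only [mem_image₂] at hvk hvl
    obtain ⟨b, hb, c, hc, rfl⟩ := hvk
    obtain ⟨b', hb', c', hc', he⟩ := hvl
    obtain ⟨a, ha⟩ := hA k hk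
    have h0 : (a - a) + (b' - b) + (c - c') = 0 := by
      have : (a - a) + (b' - b) + (c - c') = (b' - c') - (b - c) := by abel
      rw [this, he, sub_self]
    exact hkl (h k hk l hl k hk (Or.inr (Or.inr rfl)) a ha a ha b hb b' hb' c' hc' c hc h0).1

end Shadow

section Formulas

open FirstOrder FirstOrder.Language

variable {e m k : ℕ}

/-- Relabelling of `φ_I`'s variables inside the shadow formula: `x` bound, `y` free. -/
def relabI (e m k : ℕ) : Fin e ⊕ Fin k → (Fin m ⊕ Fin k) ⊕ (Fin e ⊕ (Fin m ⊕ Fin m))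
  | Sum.inl xi => Sum.inr (Sum.inl xi)
  | Sum.inr yi => Sum.inl (Sum.inr yi)

/-- Relabelling of `φ_B`'s variables: `x`, `b` bound, `y` free. -/
def relabB (e m k : ℕ) : (Fin e ⊕ Fin m) ⊕ Fin k → (Fin m ⊕ Fin k) ⊕ (Fin e ⊕ (Fin m ⊕ Fin m))
  | Sum.inl (Sum.inl xi) => Sum.inr (Sum.inl xi)
  | Sum.inl (Sum.inr bi) => Sum.inr (Sum.inr (Sum.inl bi))
  | Sum.inr yi => Sum.inl (Sum.inr yi)

/-- Relabelling of `φ_C`'s variables: `x`, `c` bound, `y` free. -/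
def relabC (e m k : ℕ) : (Fin e ⊕ Fin m) ⊕ Fin k → (Fin m ⊕ Fin k) ⊕ (Fin e ⊕ (Fin m ⊕ Fin m))
  | Sum.inl (Sum.inl xi) => Sum.inr (Sum.inl xi)
  | Sum.inl (Sum.inr ci) => Sum.inr (Sum.inr (Sum.inr ci))
  | Sum.inr yi => Sum.inl (Sum.inr yi)

/-- The ring formula `τ(w; y) := ∃x ∃b ∃c, φ_I(x;y) ∧ φ_B(x,b;y) ∧ φ_C(x,c;y) ∧ ⋀_i w_i = b_i − c_i`
cutting out the shadow `⋃_{x ∈ I} (B_x − C_x)`. -/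
noncomputable def shadowFormula (φI : Language.ring.Formula (Fin e ⊕ Fin k))
    (φB φC : Language.ring.Formula ((Fin e ⊕ Fin m) ⊕ Fin k)) :
    Language.ring.Formula (Fin m ⊕ Fin k) :=
  Formula.iExs (Fin e ⊕ (Fin m ⊕ Fin m))
    (φI.relabel (relabI e m k) ⊓ φB.relabel (relabB e m k) ⊓ φC.relabel (relabC e m k) ⊓
      Formula.iInf fun i : Fin m =>
        Term.equal (Term.var (Sum.inl (Sum.inl i)))
          (Term.var (Sum.inr (Sum.inr (Sum.inl i))) + -Term.var (Sum.inr (Sum.inr (Sum.inr i)))))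

/-- Relabelling of `φ_A`'s variables presenting `A_x` with parameters `(x, y)` appended. -/
def relabA (e m k : ℕ) : (Fin e ⊕ Fin m) ⊕ Fin k → Fin m ⊕ Fin (e + k)
  | Sum.inl (Sum.inl xi) => Sum.inr (Fin.castAdd k xi)
  | Sum.inl (Sum.inr vi) => Sum.inl vi
  | Sum.inr yi => Sum.inr (Fin.natAdd e yi)

/-- The ring formula `α(v; x, y) := φ_A(x, v; y)` cutting out the block `A_x`. -/
def blockFormula (φA : Language.ring.Formula ((Fin e ⊕ Fin m) ⊕ Fin k)) :
    Language.ring.Formula (Fin m ⊕ Fin (e + k)) :=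
  φA.relabel (relabA e m k)

theorem realize_formula_iInf {L : Language} {M : Type*} [L.Structure M] [Nonempty M] {α β : Type*}
    [Finite β] {f : β → L.Formula α} {v : α → M} :
    (Formula.iInf f).Realize v ↔ ∀ b, (f b).Realize v := by
  simp only [Formula.iInf, Formula.Realize, BoundedFormula.realize_iInf]

variable {F : Type} [Field F] [FirstOrder.Ring.CompatibleRing F]

/-- Realisation of the shadow formula. -/
theorem mem_bcShadow_iff_realize [DecidableEq F] {φI : Language.ring.Formula (Fin e ⊕ Fin k)}
    {φB φC : Language.ring.Formula ((Fin e ⊕ Fin m) ⊕ Fin k)} {y : Fin k → F}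
    {I : Finset (Fin e → F)} {B C : (Fin e → F) → Finset (Fin m → F)}
    (hI : ∀ x, x ∈ I ↔ φI.Realize (Sum.elim x y))
    (hB : ∀ x v, v ∈ B x ↔ φB.Realize (Sum.elim (Sum.elim x v) y))
    (hC : ∀ x v, v ∈ C x ↔ φC.Realize (Sum.elim (Sum.elim x v) y)) (w : Fin m → F) :
    w ∈ bcShadow I B C ↔ (shadowFormula φI φB φC).Realize (Sum.elim w y) := by
  classical
  simp only [bcShadow, mem_biUnion, mem_image₂, shadowFormula, Formula.realize_iExs,
    Formula.realize_inf, Formula.realize_relabel, realize_formula_iInf, Formula.realize_equal,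
    Term.realize_var, Sum.elim_inl, Sum.elim_inr, FirstOrder.Ring.realize_add,
    FirstOrder.Ring.realize_neg]
  constructor
  · rintro ⟨x, hx, b, hb, c, hc, rfl⟩
    refine ⟨Sum.elim x (Sum.elim b c), ⟨⟨?_, ?_⟩, ?_⟩, ?_⟩
    · rw [hI] at hx
      convert hx using 2
      funext a; cases a <;> rfl
    · rw [hB] at hb
      convert hb using 2
      funext a; rcases a with (a | a) | a <;> rfl
    · rw [hC] at hc
      convert hc using 2
      funext a; rcases a with (a | a) | a <;> rfl
    · intro i
      simp [sub_eq_add_neg]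
  · rintro ⟨g, ⟨⟨hx, hb⟩, hc⟩, hw⟩
    refine ⟨g ∘ Sum.inl, ?_, g ∘ Sum.inr ∘ Sum.inl, ?_, g ∘ Sum.inr ∘ Sum.inr, ?_, ?_⟩
    · rw [hI]
      convert hx using 2
      funext a; cases a <;> rfl
    · rw [hB]
      convert hb using 2
      funext a; rcases a with (a | a) | a <;> rfl
    · rw [hC]
      convert hc using 2
      funext a; rcases a with (a | a) | a <;> rfl
    · funext i
      have := hw i
      simp only [Function.comp_apply, Pi.sub_apply]
      rw [this, sub_eq_add_neg]

/-- Realisation of the block formula with appended parameters `Fin.append x y`. -/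
theorem mem_block_iff_realize {φA : Language.ring.Formula ((Fin e ⊕ Fin m) ⊕ Fin k)}
    {y : Fin k → F} {A : (Fin e → F) → Finset (Fin m → F)}
    (hA : ∀ x v, v ∈ A x ↔ φA.Realize (Sum.elim (Sum.elim x v) y)) (x : Fin e → F)
    (v : Fin m → F) : v ∈ A x ↔ (blockFormula φA).Realize (Sum.elim v (Fin.append x y)) := by
  rw [hA, blockFormula, Formula.realize_relabel]
  refine Iff.of_eq (congrArg _ ?_)
  funext a
  rcases a with (a | a) | a
  · simp [relabA]
  · simp [relabA]
  · simp [relabA]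

end Formulas

/-- **Ideator k=2's named fact, verbatim** (`ChebotarevRecurrenceSketch.lean`,
`DefinableTranslateRecurrence`): recurrence of translates for definable sets over finite fields.
For ring formulas `τ(w; ȳ)` and `α(v; ȳ')` there are `Q, K, C, c > 0` such that in every finite
field with `|F| ≥ Q`, for all `ȳ` there is an exceptional set `E`, `|E| ≤ C|F|^{m−1}`, such that for
all `ȳ'`, whenever `|A| > K`, every `t ∈ T ∖ E` has `c|A|² ≤ #{(a₀,a) ∈ A² : t + a − a₀ ∈ T}`.
(Kiefe 1976 / CDM (2.7) + Lang–Weil + uniform Chebotarev; see both negative notes.) -/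
def DefinableTranslateRecurrence : Prop :=
  open scoped Classical in
  ∀ (m n n' : ℕ) (τ : FirstOrder.Language.ring.Formula (Fin m ⊕ Fin n))
    (α : FirstOrder.Language.ring.Formula (Fin m ⊕ Fin n')),
    ∃ (Q K : ℕ) (C c : ℝ), 0 < c ∧
      ∀ (F : Type) [Field F] [Fintype F] [FirstOrder.Ring.CompatibleRing F],
        Q ≤ Fintype.card F → ∀ (y : Fin n → F), ∃ E : Finset (Fin m → F),
          (E.card : ℝ) ≤ C * (Fintype.card F : ℝ) ^ ((m : ℝ) - 1) ∧
          ∀ (y' : Fin n' → F) (T A : Finset (Fin m → F)),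
            (∀ w, w ∈ T ↔ τ.Realize (Sum.elim w y)) →
            (∀ v, v ∈ A ↔ α.Realize (Sum.elim v y')) →
            K < A.card → ∀ t ∈ T, t ∉ E →
              c * (A.card : ℝ) ^ 2 ≤
                (((A ×ˢ A).filter fun p : (Fin m → F) × (Fin m → F) => t + p.2 - p.1 ∈ T).card : ℝ)

/-- **From recurrence to the (rotated) shadow bound.**  Under the pairwise clause, if the shadow
`T = ⋃_x (B_x − C_x)` and the blocks `A_x` are as in `DefinableTranslateRecurrence` with
constants `K, c` and exceptional set `E`, then `Σ_{x : |A_x| > max K ⌈1/c⌉} |B_x||C_x| ≤ |E|`. -/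
theorem bcShadow_le_of_recurrence {F : Type} [Field F] [Fintype F] [DecidableEq F] {e m : ℕ}
    {I : Finset (Fin e → F)} {A B C : (Fin e → F) → Finset (Fin m → F)}
    (h : PairwiseClause I A B C) (E : Finset (Fin m → F)) {K : ℕ} {c : ℝ} (hc : 0 < c)
    (hrec : ∀ x ∈ I, K < (A x).card → ∀ t ∈ bcShadow I B C, t ∉ E →
      c * ((A x).card : ℝ) ^ 2 ≤ ((((A x) ×ˢ (A x)).filter
        fun p : (Fin m → F) × (Fin m → F) => t + p.2 - p.1 ∈ bcShadow I B C).card : ℝ)) :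
    ∑ x ∈ I.filter (fun x => max K (Nat.ceil (1 / c)) < (A x).card), (B x).card * (C x).card
      ≤ E.card := by
  classical
  set I₁ := I.filter (fun x => max K (Nat.ceil (1 / c)) < (A x).card) with hI₁
  have hI₁I : I₁ ⊆ I := filter_subset _ _
  have hA₁ : ∀ x ∈ I₁, (A x).Nonempty := fun x hx =>
    card_pos.1 (lt_of_le_of_lt (Nat.zero_le _) (mem_filter.1 hx).2)
  -- the partial shadow over `I₁` is a packing of the right size, contained in the full shadow
  have hcard : (bcShadow I₁ B C).card = ∑ x ∈ I₁, (B x).card * (C x).card :=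
    card_bcShadow (pairwiseClause_mono hI₁I h) hA₁
  have hsub : bcShadow I₁ B C ⊆ bcShadow I B C := by
    intro w hw
    simp only [bcShadow, mem_biUnion] at hw ⊢
    obtain ⟨x, hx, hw⟩ := hw
    exact ⟨x, hI₁I hx, hw⟩
  rw [← hcard]
  by_contra hlt
  push Not at hlt
  -- a non-exceptional point of the partial shadow
  obtain ⟨t, ht, htE⟩ : ∃ t ∈ bcShadow I₁ B C, t ∉ E := by
    by_contra hall
    push Not at hall
    exact absurd (card_le_card (show bcShadow I₁ B C ⊆ E from hall)) (not_le.2 hlt)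
  have ht' := ht
  simp only [bcShadow, mem_biUnion, mem_image₂] at ht'
  obtain ⟨x, hx, b, hb, c', hc', rfl⟩ := ht'
  obtain ⟨hxI, hxA⟩ := mem_filter.1 hx
  have hK : K < (A x).card := lt_of_le_of_lt (le_max_left _ _) hxA
  have hrecx := hrec x hxI hK (b - c') (hsub ht) htE
  -- but only diagonal pairs translate `t` into the shadow
  have hdiag : ((A x) ×ˢ (A x)).filter
      (fun p : (Fin m → F) × (Fin m → F) => (b - c') + p.2 - p.1 ∈ bcShadow I B C)
        ⊆ (A x).image fun a => (a, a) := by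
    intro p hp
    obtain ⟨hp, hmem⟩ := mem_filter.1 hp
    obtain ⟨h1, h2⟩ := mem_product.1 hp
    simp only [bcShadow, mem_biUnion, mem_image₂] at hmem
    obtain ⟨j, hj, b'', hb'', c'', hc'', he⟩ := hmem
    have : p.2 = p.1 := by
      by_contra hne
      exact isolating_translates h hxI hb hc' h1 h2 hne hj hb'' hc'' he.symm
    exact mem_image.2 ⟨p.1, h1, Prod.ext rfl this.symm⟩
  have hle : ((((A x) ×ˢ (A x)).filter
      fun p : (Fin m → F) × (Fin m → F) => (b - c') + p.2 - p.1 ∈ bcShadow I B C).card : ℝ)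
        ≤ (A x).card := by
    exact_mod_cast (card_le_card hdiag).trans card_image_le
  have hA0 : (0 : ℝ) < (A x).card := by exact_mod_cast (hA₁ x hx).card_pos
  have h1 : c * ((A x).card : ℝ) ≤ 1 := by
    have := hrecx.trans hle
    rw [pow_two, ← mul_assoc] at this
    exact le_of_mul_le_mul_right (by linarith) hA0
  have h2 : (Nat.ceil (1 / c) : ℝ) < (A x).card := by
    exact_mod_cast lt_of_le_of_lt (le_max_right _ _) hxA
  have h3 : 1 / c ≤ (Nat.ceil (1 / c) : ℝ) := Nat.le_ceil _
  have h4 : 1 / c < (A x).card := h3.trans_lt h2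
  rw [div_lt_iff₀ hc] at h4
  linarith [mul_comm c ((A x).card : ℝ)]

/-- **Ideator k=2's conditional refutation, PROVED:** `DefinableTranslateRecurrence → ¬ PairwiseCurvedTilingsLC`.
(τ := `shadowFormula φI φB φC`, α := `blockFormula φA`; the recurrence gives the rotated shadow
bound `Σ_{|A_x| large} |B_x||C_x| ≤ C|F|^{m−1}` by `bcShadow_le_of_recurrence`; then
`mass_le_of_shadowBound` for the rotated family `(C, A, B)` and the final count.) -/
theorem notLC_of_recurrence : DefinableTranslateRecurrence → ¬ PairwiseCurvedTilingsLC := by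
  intro hR hLC
  classical
  obtain ⟨e, m, k, φI, φA, φB, φC, hfam⟩ := hLC
  obtain ⟨Q, K, Cc, c, hc, hrec⟩ := hR m k (e + k) (shadowFormula φI φB φC) (blockFormula φA)
  set Cb : ℕ := max K (Nat.ceil (1 / c)) with hCb
  set ε : ℝ := 1 / ((m : ℝ) + 1) with hεdef
  have hm0 : (0 : ℝ) ≤ m := Nat.cast_nonneg m
  have hε : 0 < ε := by rw [hεdef]; positivity
  have hε1 : ε ≤ 1 := by
    rw [hεdef, div_le_one (by linarith)]; linarith
  have hmε : (m : ℝ) * ε ≤ 1 := by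
    rw [hεdef, mul_one_div, div_le_one (by linarith)]; linarith
  obtain ⟨η, hη, hall⟩ := hfam ε hε
  -- `Cc` may be negative a priori; work with `C₁ := max Cc 0` rounded up to a natural
  set C₁ : ℕ := max Cb (Nat.ceil (max Cc 0)) with hC₁
  set Kc : ℝ := (C₁ : ℝ) + (2 + C₁) / 3 with hK
  have hK0 : 0 < Kc := by rw [hK]; positivity
  set N : ℕ := Nat.ceil ((Kc + 1) ^ (1 / η)) with hN
  obtain ⟨F, instF, instFin, instCR, hchar, y, I, A, B, C', hI, hA, hB, hC, hpair, hmass⟩ :=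
    hall (max Q (max N 2))
  have hcardF : max Q (max N 2) ≤ Fintype.card F := hchar.trans (ringChar_le_card F)
  set q : ℝ := (Fintype.card F : ℝ) with hqdef
  have hq2 : (2 : ℝ) ≤ q := by
    rw [hqdef]; exact_mod_cast le_trans (le_max_right _ _) (le_trans (le_max_right _ _) hcardF)
  have hq1 : (1 : ℝ) ≤ q := by linarith
  have hq0 : (0 : ℝ) < q := by linarith
  have hKq : Kc < q ^ η := by
    have h1 : (Kc + 1) ^ (1 / η) ≤ q := by
      have : (N : ℝ) ≤ q := by
        rw [hqdef]; exact_mod_cast le_trans (le_max_left _ _) (le_trans (le_max_right _ _) hcardF)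
      exact le_trans (Nat.le_ceil _) this
    have h2 : Kc + 1 ≤ q ^ η := by
      calc Kc + 1 = ((Kc + 1) ^ (1 / η)) ^ η := by
            rw [← Real.rpow_mul (by positivity), one_div, inv_mul_cancel₀ hη.ne', Real.rpow_one]
        _ ≤ q ^ η := Real.rpow_le_rpow (by positivity) h1 hη.le
    linarith
  -- recurrence data for this field and these parameters
  obtain ⟨E, hE, hrecE⟩ := hrec F (le_trans (le_max_left _ _) hcardF) y
  have hrec' : ∀ x ∈ I, K < (A x).card → ∀ t ∈ bcShadow I B C', t ∉ E →
      c * ((A x).card : ℝ) ^ 2 ≤ ((((A x) ×ˢ (A x)).filter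
        fun p : (Fin m → F) × (Fin m → F) => t + p.2 - p.1 ∈ bcShadow I B C').card : ℝ) := by
    intro x _ hK t ht htE
    have := hrecE (Fin.append x y) (bcShadow I B C') (A x)
      (mem_bcShadow_iff_realize hI hB hC) (mem_block_iff_realize hA x) hK t ht htE
    convert this using 2
  have hsh := bcShadow_le_of_recurrence hpair E hc hrec'
  -- the rotated shadow bound with the natural constant `C₁ ≥ Cb`
  have hshadow : ∑ x ∈ I.filter (fun x => C₁ < (A x).card), ((C' x).card : ℝ) * (B x).card
      ≤ C₁ * q ^ ((m : ℝ) - 1) := by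
    have hsub : I.filter (fun x => C₁ < (A x).card) ⊆ I.filter fun x => Cb < (A x).card := by
      intro x hx
      obtain ⟨hxI, hxA⟩ := mem_filter.1 hx
      exact mem_filter.2 ⟨hxI, lt_of_le_of_lt (le_max_left _ _) hxA⟩
    calc ∑ x ∈ I.filter (fun x => C₁ < (A x).card), ((C' x).card : ℝ) * (B x).card
        ≤ ∑ x ∈ I.filter (fun x => Cb < (A x).card), ((C' x).card : ℝ) * (B x).card :=
          sum_le_sum_of_subset_of_nonneg hsub fun x _ _ => by positivity
      _ = ((∑ x ∈ I.filter (fun x => Cb < (A x).card), (B x).card * (C' x).card : ℕ) : ℝ) := by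
          push_cast
          exact sum_congr rfl fun x _ => mul_comm _ _
      _ ≤ E.card := by exact_mod_cast hsh
      _ ≤ Cc * q ^ ((m : ℝ) - 1) := hE
      _ ≤ C₁ * q ^ ((m : ℝ) - 1) := by
          gcongr
          calc Cc ≤ max Cc 0 := le_max_left _ _
            _ ≤ (Nat.ceil (max Cc 0) : ℝ) := Nat.le_ceil _
            _ ≤ (C₁ : ℝ) := by rw [hC₁]; exact_mod_cast le_max_right _ _
  -- mass bound for the rotated family `(C', A, B)`
  have hH : (Fintype.card (Fin m → F) : ℝ) = q ^ (m : ℝ) := by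
    rw [Real.rpow_natCast, Fintype.card_fun, Fintype.card_fin]; push_cast; rfl
  have hrot : PairwiseClause I C' A B := pairwiseClause_rotate (pairwiseClause_rotate hpair)
  have hmassle := mass_le_of_shadowBound I C' A B hrot C₁ hq1 m hH hshadow hε hε1 hmε
  have hmass' : q ^ ((m : ℝ) + η) ≤
      ∑ x ∈ I, (((C' x).card * (A x).card * (B x).card : ℕ) : ℝ) ^ ((2 + ε) / 3) := by
    calc q ^ ((m : ℝ) + η) ≤ _ := hmass
      _ = _ := sum_congr rfl fun x _ => by congr 2; ring
  have hlt : Kc * q ^ (m : ℝ) < q ^ ((m : ℝ) + η) := by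
    rw [Real.rpow_add hq0, mul_comm]
    exact mul_lt_mul_of_pos_left hKq (Real.rpow_pos_of_pos hq0 _)
  exact absurd (hmass'.trans hmassle) (not_le.2 hlt)

end Summit.MatrixMultiplication.MatrixMultiplication.Cruxes.PairwiseCurvedTilingsLC.Negative
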